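import Summits.NavierStokesRegularity.FunctionalMining.StrainMoment
import Summits.NavierStokesRegularity.FunctionalMining.VorticityL4Pointwise
import HarnessLib

/-!
# FunctionalMining — pointwise and `L²` Cauchy–Schwarz steps for the strain moment `∫|S|⁴`
# (toward row `ES.absS.q=4|T_LD|G1`)

Search for candidate a priori estimates; no regularity claim. Cell `pub-nsfunc`, prove seat
(gen 9). Static inequalities on `T^d`, nothing about Navier–Stokes: with `Q = |S|²`
(`torusStrainSqAt`), `g = ∑ₖ‖∂ₖv‖²`, the nonlinear production density
`N = ∑ᵢⱼ Sᵢⱼ ∑ₖ(∂ᵢv)ₖ(∂ₖv)ⱼ` and, for a scalar `P`, the pressure density `Π = ∑ᵢⱼ Sᵢⱼ ∂ᵢ∂ⱼP`,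
`h = ∑ᵢⱼ|∂ᵢ∂ⱼP|`:
`|N| ≤ √Q · g`, `|Π| ≤ √Q · h` (Cauchy–Schwarz in the index pairs), hence
`(∫QN)² ≤ (∫Q²)∫Qg²`, `(∫Qg²)² ≤ (∫Q²)∫g⁴`, `(∫QΠ)² ≤ (∫Q²)∫Qh²`, `(∫Qh²)² ≤ (∫Q²)∫h⁴`,
and the Cauchy–Schwarz interpolations `(∫Q⁴)² ≤ (∫Q²)∫Q⁶`, `(∫Q²)⁵ ≤ (∫Q)⁴∫Q⁶`.
These are the inputs `h1, h2, h4, h5` of the exponent bookkeeping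
`VorticityL4.production_pow_fourteen_le` for the strain ladder at `q = 4`.
-/

noncomputable section

open MeasureTheory Finset Set
open scoped InnerProductSpace RealInnerProductSpace ContDiff

namespace Summit.NavierStokesRegularity.FunctionalMining

open Literature.Analysis.FunctionSpaces Literature.Analysis.FunctionSpaces.Torus
  Literature.Analysis.FluidPDE

namespace StrainL4

variable {d : Type*} [Fintype d] [DecidableEq d]

/-! ## 1. Pointwise Cauchy–Schwarz -/

/-- `|∑ᵢⱼ Sᵢⱼ Mᵢⱼ| ≤ √|S|² · √(∑ᵢⱼ Mᵢⱼ²)`. [ours; elementary] -/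
theorem abs_sum_strain_mul_le (v : UnitAddTorus d → EuclideanSpace ℝ d) (x : UnitAddTorus d)
    (M : d → d → ℝ) :
    |∑ i, ∑ j, (Torus.partialDeriv j v x i + Torus.partialDeriv i v x j) / 2 * M i j| ≤
      Real.sqrt (torusStrainSqAt v x) * Real.sqrt (∑ i, ∑ j, M i j ^ 2) := by
  set T : d → d → ℝ := fun i j => (Torus.partialDeriv j v x i + Torus.partialDeriv i v x j) / 2
    with hT
  have hQ : torusStrainSqAt v x = ∑ i, ∑ j, T i j ^ 2 := rfl
  have hCS : (∑ i, ∑ j, T i j * M i j) ^ 2 ≤ (∑ i, ∑ j, T i j ^ 2) * ∑ i, ∑ j, M i j ^ 2 := by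
    rw [← Fintype.sum_prod_type' (fun i j => T i j * M i j),
      ← Fintype.sum_prod_type' (fun i j => T i j ^ 2), ← Fintype.sum_prod_type' (fun i j => M i j ^ 2)]
    exact Finset.sum_mul_sq_le_sq_mul_sq _ _ _
  rw [← Real.sqrt_mul (torusStrainSqAt_nonneg v x), hQ]
  exact Real.abs_le_sqrt hCS

/-- `∑ᵢⱼ (∑ₖ (∂ᵢv)ₖ(∂ₖv)ⱼ)² ≤ (∑ₖ‖∂ₖv‖²)²`. [ours; elementary] -/
theorem sum_gradgrad_sq_le (v : UnitAddTorus d → EuclideanSpace ℝ d) (x : UnitAddTorus d) :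
    ∑ i, ∑ j, (∑ k, Torus.partialDeriv i v x k * Torus.partialDeriv k v x j) ^ 2 ≤
      (∑ k, ‖Torus.partialDeriv k v x‖ ^ 2) ^ 2 := by
  set a : d → d → ℝ := fun i k => Torus.partialDeriv i v x k with ha
  have hg : ∑ k, ‖Torus.partialDeriv k v x‖ ^ 2 = ∑ i, ∑ k, a i k ^ 2 :=
    Finset.sum_congr rfl fun i _ => VorticityL4.norm_partialDeriv_sq_eq_sum v i x
  have hMij : ∀ i j, (∑ k, a i k * a k j) ^ 2 ≤ (∑ k, a i k ^ 2) * ∑ k, a k j ^ 2 := fun i j =>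
    Finset.sum_mul_sq_le_sq_mul_sq _ _ _
  rw [hg]
  calc ∑ i, ∑ j, (∑ k, a i k * a k j) ^ 2 ≤ ∑ i, ∑ j, (∑ k, a i k ^ 2) * ∑ k, a k j ^ 2 :=
        Finset.sum_le_sum fun i _ => Finset.sum_le_sum fun j _ => hMij i j
    _ = (∑ i, ∑ k, a i k ^ 2) * ∑ j, ∑ k, a k j ^ 2 := by rw [Finset.sum_mul_sum]
    _ = (∑ i, ∑ k, a i k ^ 2) * ∑ k, ∑ j, a k j ^ 2 := by
        rw [Finset.sum_comm (f := fun j k => a k j ^ 2)]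
    _ = (∑ i, ∑ k, a i k ^ 2) ^ 2 := by ring

/-- **`|N| ≤ √|S|² · ∑ₖ‖∂ₖv‖²`** for the nonlinear production density
`N = ∑ᵢⱼ Sᵢⱼ ∑ₖ(∂ᵢv)ₖ(∂ₖv)ⱼ`. [ours; elementary] -/
theorem abs_nonlinearDensity_le (v : UnitAddTorus d → EuclideanSpace ℝ d) (x : UnitAddTorus d) :
    |∑ i, ∑ j, (Torus.partialDeriv j v x i + Torus.partialDeriv i v x j) / 2 *
        ∑ k, Torus.partialDeriv i v x k * Torus.partialDeriv k v x j| ≤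
      Real.sqrt (torusStrainSqAt v x) * ∑ k, ‖Torus.partialDeriv k v x‖ ^ 2 := by
  have h := abs_sum_strain_mul_le v x
    (fun i j => ∑ k, Torus.partialDeriv i v x k * Torus.partialDeriv k v x j)
  refine h.trans (mul_le_mul_of_nonneg_left ?_ (Real.sqrt_nonneg _))
  have hg0 : 0 ≤ ∑ k, ‖Torus.partialDeriv k v x‖ ^ 2 := Finset.sum_nonneg fun k _ => sq_nonneg _
  calc Real.sqrt (∑ i, ∑ j, (∑ k, Torus.partialDeriv i v x k * Torus.partialDeriv k v x j) ^ 2)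
      ≤ Real.sqrt ((∑ k, ‖Torus.partialDeriv k v x‖ ^ 2) ^ 2) :=
        Real.sqrt_le_sqrt (sum_gradgrad_sq_le v x)
    _ = ∑ k, ‖Torus.partialDeriv k v x‖ ^ 2 := Real.sqrt_sq hg0

/-- **`|Π| ≤ √|S|² · ∑ᵢⱼ|Hᵢⱼ|`** for `Π = ∑ᵢⱼ Sᵢⱼ Hᵢⱼ` (`√(∑H²) ≤ ∑|H|`). [ours; elementary] -/
theorem abs_sum_strain_mul_le_sum_abs (v : UnitAddTorus d → EuclideanSpace ℝ d) (x : UnitAddTorus d)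
    (H : d → d → ℝ) :
    |∑ i, ∑ j, (Torus.partialDeriv j v x i + Torus.partialDeriv i v x j) / 2 * H i j| ≤
      Real.sqrt (torusStrainSqAt v x) * ∑ i, ∑ j, |H i j| := by
  refine (abs_sum_strain_mul_le v x H).trans (mul_le_mul_of_nonneg_left ?_ (Real.sqrt_nonneg _))
  have h0 : 0 ≤ ∑ i, ∑ j, |H i j| :=
    Finset.sum_nonneg fun i _ => Finset.sum_nonneg fun j _ => abs_nonneg _
  have hle : ∑ i, ∑ j, H i j ^ 2 ≤ (∑ i, ∑ j, |H i j|) ^ 2 := by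
    rw [← Fintype.sum_prod_type' (fun i j => H i j ^ 2), ← Fintype.sum_prod_type' (fun i j => |H i j|)]
    have e : ∑ p : d × d, H p.1 p.2 ^ 2 = ∑ p : d × d, |H p.1 p.2| ^ 2 :=
      Finset.sum_congr rfl fun p _ => (sq_abs _).symm
    rw [e]
    exact Finset.sum_sq_le_sq_sum_of_nonneg fun p _ => abs_nonneg _
  calc Real.sqrt (∑ i, ∑ j, H i j ^ 2) ≤ Real.sqrt ((∑ i, ∑ j, |H i j|) ^ 2) := Real.sqrt_le_sqrt hle
    _ = ∑ i, ∑ j, |H i j| := Real.sqrt_sq h0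

/-! ## 2. Continuity of the densities -/

/-- `x ↦ |S(x)|²` is continuous for smooth `v`. [folklore] -/
theorem continuous_strainSqAt {v : UnitAddTorus d → EuclideanSpace ℝ d} (hv : Torus.IsSmooth v) :
    Continuous (torusStrainSqAt v) := by
  have hc : ∀ i k, Continuous fun x => Torus.partialDeriv i v x k := fun i k =>
    ((hv.partialDeriv i).apply k).continuous
  show Continuous fun x => ∑ i, ∑ j,
    ((Torus.partialDeriv j v x i + Torus.partialDeriv i v x j) / 2) ^ 2
  exact continuous_finsetSum _ fun i _ => continuous_finsetSum _ fun j _ =>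
    (((hc j i).add (hc i j)).div_const 2).pow 2

/-- The nonlinear production density is continuous for smooth `v`. [folklore] -/
theorem continuous_nonlinearDensity {v : UnitAddTorus d → EuclideanSpace ℝ d}
    (hv : Torus.IsSmooth v) :
    Continuous fun x => ∑ i, ∑ j, (Torus.partialDeriv j v x i + Torus.partialDeriv i v x j) / 2 *
      ∑ k, Torus.partialDeriv i v x k * Torus.partialDeriv k v x j := by
  have hc : ∀ i k, Continuous fun x => Torus.partialDeriv i v x k := fun i k =>
    ((hv.partialDeriv i).apply k).continuous
  refine continuous_finsetSum _ fun i _ => continuous_finsetSum _ fun j _ => ?_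
  exact (((hc j i).add (hc i j)).div_const 2).mul
    (continuous_finsetSum _ fun k _ => (hc i k).mul (hc k j))

/-- The pressure density `∑ᵢⱼ Sᵢⱼ ∂ᵢ∂ⱼP` is continuous for smooth `v`, `P`. [folklore] -/
theorem continuous_pressureDensity {v : UnitAddTorus d → EuclideanSpace ℝ d} {P : UnitAddTorus d → ℝ}
    (hv : Torus.IsSmooth v) (hP : Torus.IsSmooth P) :
    Continuous fun x => ∑ i, ∑ j, (Torus.partialDeriv j v x i + Torus.partialDeriv i v x j) / 2 *
      Torus.partialDeriv i (Torus.partialDeriv j P) x := by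
  have hc : ∀ i k, Continuous fun x => Torus.partialDeriv i v x k := fun i k =>
    ((hv.partialDeriv i).apply k).continuous
  refine continuous_finsetSum _ fun i _ => continuous_finsetSum _ fun j _ => ?_
  exact (((hc j i).add (hc i j)).div_const 2).mul ((hP.partialDeriv j).partialDeriv i).continuous

/-- `x ↦ ∑ᵢⱼ |∂ᵢ∂ⱼP(x)|` is continuous for smooth `P`. [folklore] -/
theorem continuous_hessAbs {P : UnitAddTorus d → ℝ} (hP : Torus.IsSmooth P) :
    Continuous fun x => ∑ i, ∑ j, |Torus.partialDeriv i (Torus.partialDeriv j P) x| :=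
  continuous_finsetSum _ fun i _ => continuous_finsetSum _ fun j _ =>
    ((hP.partialDeriv j).partialDeriv i).continuous.abs

/-! ## 3. Cauchy–Schwarz in `L²(T^d)` -/

omit [DecidableEq d] in
/-- Weighted Cauchy–Schwarz: if `|F| ≤ √Q · G` pointwise with `Q ≥ 0` and everything continuous,
then `(∫ Q F)² ≤ (∫ Q²) ∫ Q G²`. [ours; elementary] -/
theorem sq_integral_mul_le_of_abs_le {Q F G : UnitAddTorus d → ℝ} (hQ : Continuous Q)
    (hG : Continuous G) (hQ0 : ∀ x, 0 ≤ Q x)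
    (hFG : ∀ x, |F x| ≤ Real.sqrt (Q x) * G x) :
    (∫ x, Q x * F x) ^ 2 ≤ (∫ x, Q x ^ 2) * ∫ x, Q x * G x ^ 2 := by
  have hsq : Continuous fun x => Real.sqrt (Q x) * G x := (hQ.sqrt).mul hG
  have h1 : |∫ x, Q x * F x| ≤ ∫ x, Q x * (Real.sqrt (Q x) * G x) := by
    refine (abs_integral_le_integral_abs).trans ?_
    refine integral_mono_of_nonneg (ae_of_all _ fun x => abs_nonneg _)
      ((hQ.mul hsq).integrable_unitAddTorus) (ae_of_all _ fun x => ?_)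
    show |Q x * F x| ≤ Q x * (Real.sqrt (Q x) * G x)
    rw [abs_mul, abs_of_nonneg (hQ0 x)]
    exact mul_le_mul_of_nonneg_left (hFG x) (hQ0 x)
  have h2 := sq_integral_mul_le (f := Q) (g := fun x => Real.sqrt (Q x) * G x) hQ hsq
  have e : ∫ x, (Real.sqrt (Q x) * G x) ^ 2 = ∫ x, Q x * G x ^ 2 :=
    integral_congr_ae (ae_of_all _ fun x => by
      show (Real.sqrt (Q x) * G x) ^ 2 = Q x * G x ^ 2
      rw [mul_pow, Real.sq_sqrt (hQ0 x)])
  rw [e] at h2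
  calc (∫ x, Q x * F x) ^ 2 = |∫ x, Q x * F x| ^ 2 := (sq_abs _).symm
    _ ≤ (∫ x, Q x * (Real.sqrt (Q x) * G x)) ^ 2 := pow_le_pow_left₀ (abs_nonneg _) h1 2
    _ ≤ (∫ x, Q x ^ 2) * ∫ x, Q x * G x ^ 2 := h2

omit [DecidableEq d] in
/-- `(∫ Q G²)² ≤ (∫ Q²) ∫ G⁴` (Cauchy–Schwarz). [ours; elementary] -/
theorem sq_integral_mul_sq_le {Q G : UnitAddTorus d → ℝ} (hQ : Continuous Q) (hG : Continuous G) :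
    (∫ x, Q x * G x ^ 2) ^ 2 ≤ (∫ x, Q x ^ 2) * ∫ x, G x ^ 4 := by
  have h := sq_integral_mul_le (f := Q) (g := fun x => G x ^ 2) hQ (hG.pow 2)
  have e : ∫ x, (G x ^ 2) ^ 2 = ∫ x, G x ^ 4 := integral_congr_ae (ae_of_all _ fun x => by ring)
  rw [e] at h
  exact h

/-! ## 4. Cauchy–Schwarz interpolation of the `|S|²`-moments -/

omit [DecidableEq d] in
/-- `(∫Q⁴)² ≤ (∫Q²) ∫Q⁶` for continuous `Q`. [folklore] -/
theorem sq_integral_pow_four_le {Q : UnitAddTorus d → ℝ} (hQ : Continuous Q) :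
    (∫ x, Q x ^ 4) ^ 2 ≤ (∫ x, Q x ^ 2) * ∫ x, Q x ^ 6 := by
  have h := sq_integral_mul_le (f := Q) (g := fun x => Q x ^ 3) hQ (hQ.pow 3)
  have e1 : ∫ x, Q x * Q x ^ 3 = ∫ x, Q x ^ 4 := integral_congr_ae (ae_of_all _ fun x => by ring)
  have e2 : ∫ x, (Q x ^ 3) ^ 2 = ∫ x, Q x ^ 6 := integral_congr_ae (ae_of_all _ fun x => by ring)
  rw [e1, e2] at h
  exact h

omit [DecidableEq d] in
/-- `(∫Q²)⁵ ≤ (∫Q)⁴ ∫Q⁶` for continuous `Q ≥ 0` (three Cauchy–Schwarz steps: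
`(∫Q²)² ≤ ∫Q ∫Q³`, `(∫Q³)² ≤ ∫Q² ∫Q⁴`, `(∫Q⁴)² ≤ ∫Q² ∫Q⁶`). [folklore] -/
theorem integral_sq_pow_five_le {Q : UnitAddTorus d → ℝ} (hQ : Continuous Q) (hQ0 : ∀ x, 0 ≤ Q x) :
    (∫ x, Q x ^ 2) ^ 5 ≤ (∫ x, Q x) ^ 4 * ∫ x, Q x ^ 6 := by
  obtain ⟨B₁, hB₁⟩ : ∃ B : ℝ, B = ∫ x, Q x := ⟨_, rfl⟩
  obtain ⟨B₂, hB₂⟩ : ∃ B : ℝ, B = ∫ x, Q x ^ 2 := ⟨_, rfl⟩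
  obtain ⟨B₃, hB₃⟩ : ∃ B : ℝ, B = ∫ x, Q x ^ 3 := ⟨_, rfl⟩
  obtain ⟨B₄, hB₄⟩ : ∃ B : ℝ, B = ∫ x, Q x ^ 4 := ⟨_, rfl⟩
  obtain ⟨B₆, hB₆⟩ : ∃ B : ℝ, B = ∫ x, Q x ^ 6 := ⟨_, rfl⟩
  have hB₁0 : 0 ≤ B₁ := by rw [hB₁]; exact integral_nonneg fun x => hQ0 x
  have hB₂0 : 0 ≤ B₂ := by rw [hB₂]; exact integral_nonneg fun x => by positivity
  have hB₃0 : 0 ≤ B₃ := by rw [hB₃]; exact integral_nonneg fun x => pow_nonneg (hQ0 x) 3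
  have hB₄0 : 0 ≤ B₄ := by rw [hB₄]; exact integral_nonneg fun x => by positivity
  have hB₆0 : 0 ≤ B₆ := by rw [hB₆]; exact integral_nonneg fun x => by positivity
  -- `B₂² ≤ B₁ B₃` : `Q² = √Q · Q^{3/2}`, as `(∫ √Q·(√Q Q))² ≤ ∫Q ∫Q³`
  have s1 : B₂ ^ 2 ≤ B₁ * B₃ := by
    have h := sq_integral_mul_le (f := fun x => Real.sqrt (Q x)) (g := fun x => Real.sqrt (Q x) * Q x)
      hQ.sqrt (hQ.sqrt.mul hQ)
    have e0 : ∫ x, Real.sqrt (Q x) * (Real.sqrt (Q x) * Q x) = B₂ := by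
      rw [hB₂]; refine integral_congr_ae (ae_of_all _ fun x => ?_)
      show Real.sqrt (Q x) * (Real.sqrt (Q x) * Q x) = Q x ^ 2
      rw [← mul_assoc, Real.mul_self_sqrt (hQ0 x)]; ring
    have e1 : ∫ x, Real.sqrt (Q x) ^ 2 = B₁ := by
      rw [hB₁]; exact integral_congr_ae (ae_of_all _ fun x => Real.sq_sqrt (hQ0 x))
    have e2 : ∫ x, (Real.sqrt (Q x) * Q x) ^ 2 = B₃ := by
      rw [hB₃]; refine integral_congr_ae (ae_of_all _ fun x => ?_)
      show (Real.sqrt (Q x) * Q x) ^ 2 = Q x ^ 3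
      rw [mul_pow, Real.sq_sqrt (hQ0 x)]; ring
    rw [e0, e1, e2] at h
    exact h
  have s2 : B₃ ^ 2 ≤ B₂ * B₄ := by
    have h := sq_integral_mul_le (f := Q) (g := fun x => Q x ^ 2) hQ (hQ.pow 2)
    have e0 : ∫ x, Q x * Q x ^ 2 = B₃ := by
      rw [hB₃]; exact integral_congr_ae (ae_of_all _ fun x => by ring)
    have e2 : ∫ x, (Q x ^ 2) ^ 2 = B₄ := by
      rw [hB₄]; exact integral_congr_ae (ae_of_all _ fun x => by ring)
    rw [e0, ← hB₂, e2] at h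
    exact h
  have s3 : B₄ ^ 2 ≤ B₂ * B₆ := by
    have h := sq_integral_pow_four_le hQ
    rw [← hB₄, ← hB₂, ← hB₆] at h
    exact h
  -- combine: `B₂⁸ ≤ B₁⁴ B₃⁴ ≤ B₁⁴ B₂² B₄² ≤ B₁⁴ B₂³ B₆`
  have h8 : B₂ ^ 8 ≤ B₁ ^ 4 * B₂ ^ 3 * B₆ := by
    have t1 : (B₂ ^ 2) ^ 4 ≤ (B₁ * B₃) ^ 4 := pow_le_pow_left₀ (by positivity) s1 4
    have t2 : (B₃ ^ 2) ^ 2 ≤ (B₂ * B₄) ^ 2 := pow_le_pow_left₀ (by positivity) s2 2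
    calc B₂ ^ 8 = (B₂ ^ 2) ^ 4 := by ring
      _ ≤ (B₁ * B₃) ^ 4 := t1
      _ = B₁ ^ 4 * (B₃ ^ 2) ^ 2 := by ring
      _ ≤ B₁ ^ 4 * (B₂ * B₄) ^ 2 := by gcongr
      _ = B₁ ^ 4 * B₂ ^ 2 * B₄ ^ 2 := by ring
      _ ≤ B₁ ^ 4 * B₂ ^ 2 * (B₂ * B₆) := by gcongr
      _ = B₁ ^ 4 * B₂ ^ 3 * B₆ := by ring
  rw [← hB₂, ← hB₁, ← hB₆]
  rcases eq_or_lt_of_le hB₂0 with h0 | hpos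
  · rw [← h0]; simp only [ne_eq, OfNat.ofNat_ne_zero, not_false_eq_true, zero_pow]; positivity
  · have h3 : 0 < B₂ ^ 3 := pow_pos hpos 3
    have key : B₂ ^ 5 * B₂ ^ 3 ≤ B₁ ^ 4 * B₆ * B₂ ^ 3 := by
      calc B₂ ^ 5 * B₂ ^ 3 = B₂ ^ 8 := by ring
        _ ≤ B₁ ^ 4 * B₂ ^ 3 * B₆ := h8
        _ = B₁ ^ 4 * B₆ * B₂ ^ 3 := by ring
    exact le_of_mul_le_mul_right key h3

end StrainL4

end Summit.NavierStokesRegularity.FunctionalMining
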